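import Summits.AtomisticToContinuum.Crystallization.Theorems.PalmUnimodularRigidityLayeredLawsSelectHcpKuhnChartDefs

/-!
# Crux `LayeredLawsSelectHcp` (stmt-AtomisticToContinuum-9226), line `mtp-prestress-split-ergodic-frame`:
# cuts and Kuhn stars for the threshold interpolation (`stub_chartInterpolation`, T4, second part)

* `exists_cut`, `norm_kuhnInv_sub_le` — a segment is cut at a horizontal plane without loss of length, so `kuhnInv` is
  `√2`-Lipschitz (Euclidean → sup) on pairs closer than `1/2`;
* `ceil_offset_cases`, `offsets_of_box` — the labels `⌈x − t⌉` read in a good box `(m, τ)` have offsets in `{0,1}³ ∪ {−1,0}³`;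
* `mem_ballLabels_two_table`, `kuhnLabel_offset_mem` — the Kuhn star of `m` lies in the graph ball of radius `2` around
  `kuhnLabel m` (fifteen explicit labels).
Anchor (registered): `sqrt2_div_25_le`.

All `[folklore]`.
-/

noncomputable section

namespace Summit.AtomisticToContinuum.Crystallization.Theorems.PalmUnimodularRigidity.LayeredLawsSelectHcp

open MeasureTheory Set
open Literature.MathematicalPhysics.StatisticalMechanics Literature.Geometry.DiscreteGeometry
open Summit.AtomisticToContinuum.Crystallization.Theorems.LayeredLawsSelectHcp.Negative.DiracLaws (GoodShell)

namespace KuhnChart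

/-! ## Cutting a segment at a horizontal plane -/

/-- **A segment crossing a horizontal plane is cut there without loss of length**: if the height `z` lies between `p₃`
and `q₃` there is `b ∈ [p, q]` with `b₃ = z` and `‖p − b‖ + ‖b − q‖ = ‖p − q‖`. [folklore] -/
theorem exists_cut (p q : EuclideanSpace ℝ (Fin 3)) {z : ℝ}
    (hz : (p 2 ≤ z ∧ z ≤ q 2) ∨ (q 2 ≤ z ∧ z ≤ p 2)) :
    ∃ b ∈ segment ℝ p q, b 2 = z ∧ ‖p - b‖ + ‖b - q‖ = ‖p - q‖ := by
  by_cases hpq : p 2 = q 2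
  · have hzp : z = p 2 := by rcases hz with ⟨h1, h2⟩ | ⟨h1, h2⟩ <;> linarith
    exact ⟨p, left_mem_segment ℝ p q, hzp.symm, by simp⟩
  · set lam : ℝ := (z - p 2) / (q 2 - p 2) with hlam
    have hne : q 2 - p 2 ≠ 0 := sub_ne_zero.2 (Ne.symm hpq)
    have hl0 : 0 ≤ lam := by
      rcases hz with ⟨h1, h2⟩ | ⟨h1, h2⟩
      · exact div_nonneg (by linarith) (by linarith)
      · exact div_nonneg_of_nonpos (by linarith) (by linarith)
    have hl1 : lam ≤ 1 := by
      rcases hz with ⟨h1, h2⟩ | ⟨h1, h2⟩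
      · rw [hlam, div_le_one (by rcases lt_or_eq_of_le (by linarith : p 2 ≤ q 2) with h | h <;> [linarith; exact absurd h hpq])]
        linarith
      · have hneg : q 2 - p 2 < 0 := by
          rcases lt_or_eq_of_le (by linarith : q 2 ≤ p 2) with h | h
          · linarith
          · exact absurd h.symm hpq
        rw [hlam, div_le_one_of_neg hneg]
        linarith
    refine ⟨p + lam • (q - p), ?_, ?_, ?_⟩
    · rw [segment_eq_image']
      exact ⟨lam, ⟨hl0, hl1⟩, rfl⟩
    · simp only [PiLp.add_apply, PiLp.smul_apply, PiLp.sub_apply, smul_eq_mul, hlam]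
      field_simp
      ring
    · have e1 : p - (p + lam • (q - p)) = lam • (p - q) := by module
      have e2 : p + lam • (q - p) - q = (1 - lam) • (p - q) := by module
      rw [e1, e2, norm_smul, norm_smul, Real.norm_eq_abs, Real.norm_eq_abs, abs_of_nonneg hl0,
        abs_of_nonneg (by linarith)]
      ring

/-- **`Φ` is `√2`-Lipschitz (Euclidean → sup) on pairs closer than a layer** (one cut at most). [folklore] -/
theorem norm_kuhnInv_sub_le {p q : EuclideanSpace ℝ (Fin 3)} (hpq : ‖p - q‖ < 1 / 2) :
    ‖kuhnInv p - kuhnInv q‖ ≤ Real.sqrt 2 * ‖p - q‖ := by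
  have hh := sqrt_twoThirds_pos
  set s := p 2 / Real.sqrt (2 / 3) with hs
  set s' := q 2 / Real.sqrt (2 / 3) with hs'
  -- heights differ by less than one layer
  have hcoord : |p 2 - q 2| ≤ ‖p - q‖ := by
    simpa using PiLp.norm_apply_le (p - q) 2
  have h23 : Real.sqrt (2 / 3) > 1 / 2 := by
    rw [gt_iff_lt, show (1 / 2 : ℝ) = Real.sqrt (1 / 4) by
      rw [show (1 / 4 : ℝ) = (1 / 2) ^ 2 by norm_num, Real.sqrt_sq (by norm_num)]]
    exact Real.sqrt_lt_sqrt (by norm_num) (by norm_num)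
  have hss : |s - s'| < 1 := by
    rw [hs, hs', ← sub_div, abs_div, abs_of_pos hh, div_lt_one hh]
    calc |p 2 - q 2| ≤ ‖p - q‖ := hcoord
      _ < 1 / 2 := hpq
      _ < Real.sqrt (2 / 3) := h23
  set k := ⌊s'⌋ with hk
  have hk1 : (k : ℝ) ≤ s' := Int.floor_le s'
  have hk2 : s' < k + 1 := Int.lt_floor_add_one s'
  rcases abs_lt.1 hss with ⟨hlo, hhi⟩
  by_cases hup : s ≤ k + 1
  · by_cases hdown : (k : ℝ) ≤ s
    · exact norm_kuhnInv_sub_le_slab hdown hup hk1 hk2.le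
    · -- cut at height `k`
      push Not at hdown
      have hz : (p 2 ≤ k * Real.sqrt (2 / 3) ∧ k * Real.sqrt (2 / 3) ≤ q 2) ∨
          (q 2 ≤ k * Real.sqrt (2 / 3) ∧ k * Real.sqrt (2 / 3) ≤ p 2) := by
        left
        constructor
        · have : s * Real.sqrt (2 / 3) = p 2 := by rw [hs]; field_simp
          nlinarith
        · have : s' * Real.sqrt (2 / 3) = q 2 := by rw [hs']; field_simp
          nlinarith
      obtain ⟨b, -, hb2, hlen⟩ := exists_cut p q hz
      have hbk : b 2 / Real.sqrt (2 / 3) = k := by rw [hb2]; field_simp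
      have h1 : ‖kuhnInv p - kuhnInv b‖ ≤ Real.sqrt 2 * ‖p - b‖ :=
        norm_kuhnInv_sub_le_slab (k := k - 1) (by push_cast; rw [← hs]; linarith) (by push_cast; rw [← hs]; linarith)
          (by rw [hbk]; push_cast; linarith) (by rw [hbk]; push_cast; linarith)
      have h2 : ‖kuhnInv b - kuhnInv q‖ ≤ Real.sqrt 2 * ‖b - q‖ :=
        norm_kuhnInv_sub_le_slab (k := k) (by rw [hbk]) (by rw [hbk]; linarith) hk1 hk2.le
      calc ‖kuhnInv p - kuhnInv q‖ = ‖(kuhnInv p - kuhnInv b) + (kuhnInv b - kuhnInv q)‖ := by rw [sub_add_sub_cancel]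
        _ ≤ ‖kuhnInv p - kuhnInv b‖ + ‖kuhnInv b - kuhnInv q‖ := norm_add_le _ _
        _ ≤ Real.sqrt 2 * ‖p - b‖ + Real.sqrt 2 * ‖b - q‖ := add_le_add h1 h2
        _ = Real.sqrt 2 * ‖p - q‖ := by rw [← mul_add, hlen]
  · -- cut at height `k + 1`
    push Not at hup
    have hz : (p 2 ≤ (k + 1) * Real.sqrt (2 / 3) ∧ (k + 1) * Real.sqrt (2 / 3) ≤ q 2) ∨
        (q 2 ≤ (k + 1) * Real.sqrt (2 / 3) ∧ (k + 1) * Real.sqrt (2 / 3) ≤ p 2) := by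
      right
      constructor
      · have : s' * Real.sqrt (2 / 3) = q 2 := by rw [hs']; field_simp
        nlinarith
      · have : s * Real.sqrt (2 / 3) = p 2 := by rw [hs]; field_simp
        nlinarith
    obtain ⟨b, -, hb2, hlen⟩ := exists_cut p q hz
    have hbk : b 2 / Real.sqrt (2 / 3) = k + 1 := by rw [hb2]; field_simp
    have h1 : ‖kuhnInv p - kuhnInv b‖ ≤ Real.sqrt 2 * ‖p - b‖ :=
      norm_kuhnInv_sub_le_slab (k := k + 1) (by push_cast; rw [← hs]; linarith) (by push_cast; rw [← hs]; linarith)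
        (by rw [hbk]; push_cast; linarith) (by rw [hbk]; push_cast; linarith)
    have h2 : ‖kuhnInv b - kuhnInv q‖ ≤ Real.sqrt 2 * ‖b - q‖ :=
      norm_kuhnInv_sub_le_slab (k := k) (by rw [hbk]; linarith) (by rw [hbk]) hk1 hk2.le
    calc ‖kuhnInv p - kuhnInv q‖ = ‖(kuhnInv p - kuhnInv b) + (kuhnInv b - kuhnInv q)‖ := by rw [sub_add_sub_cancel]
      _ ≤ ‖kuhnInv p - kuhnInv b‖ + ‖kuhnInv b - kuhnInv q‖ := norm_add_le _ _
      _ ≤ Real.sqrt 2 * ‖p - b‖ + Real.sqrt 2 * ‖b - q‖ := add_le_add h1 h2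
      _ = Real.sqrt 2 * ‖p - q‖ := by rw [← mul_add, hlen]

/-! ## The labels read by the interpolant on a Kuhn star -/

/-- **Threshold labels inside a good box.**  If `τ − 1 ≤ x − m ≤ τ` (`0 ≤ τ ≤ 1`) and `0 < t < 1`, the offset
`σ = ⌈x − t⌉ − m` is `0` or `1` for `t < τ`, `0` or `−1` for `t ≥ τ`, non-negative if `x ≥ m` and non-positive if
`x ≤ m`. [folklore] -/
theorem ceil_offset_cases {x τ t : ℝ} {m : ℤ} (hτ0 : 0 ≤ τ) (hτ1 : τ ≤ 1) (ht0 : 0 < t) (ht1 : t < 1)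
    (hlo : τ - 1 ≤ x - m) (hhi : x - m ≤ τ) :
    (t < τ → (⌈x - t⌉ - m = 0 ∨ ⌈x - t⌉ - m = 1)) ∧ (τ ≤ t → (⌈x - t⌉ - m = 0 ∨ ⌈x - t⌉ - m = -1)) ∧
      (0 ≤ x - m → 0 ≤ ⌈x - t⌉ - m) ∧ (x - m ≤ 0 → ⌈x - t⌉ - m ≤ 0) := by
  have hc : ⌈x - t⌉ - m = ⌈x - m - t⌉ := by
    rw [← Int.ceil_sub_intCast]; congr 1; ring
  rw [hc]
  have up : ∀ z : ℤ, x - m - t ≤ z → ⌈x - m - t⌉ ≤ z := fun z hz => Int.ceil_le.2 hz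
  have dn : ∀ z : ℤ, (z : ℝ) < x - m - t + 1 → z ≤ ⌈x - m - t⌉ := fun z hz => by
    have := Int.le_ceil (x - m - t)
    have h' : (z : ℝ) < ⌈x - m - t⌉ + 1 := by linarith
    exact_mod_cast Int.lt_add_one_iff.1 (by exact_mod_cast h')
  refine ⟨fun htτ => ?_, fun htτ => ?_, fun h0 => ?_, fun h0 => ?_⟩
  · have h1 : ⌈x - m - t⌉ ≤ 1 := up 1 (by push_cast; linarith)
    have h2 : 0 ≤ ⌈x - m - t⌉ := dn 0 (by push_cast; linarith)
    omega
  · have h1 : ⌈x - m - t⌉ ≤ 0 := up 0 (by push_cast; linarith)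
    have h2 : -1 ≤ ⌈x - m - t⌉ := dn (-1) (by push_cast; linarith)
    omega
  · exact dn 0 (by push_cast; linarith)
  · exact up 0 (by push_cast; linarith)

/-- The fifteen labels of the graph ball of radius `2` that the Kuhn star of an even-layer centre reads (the centre, ten
star labels and four labels at graph distance `2`). [folklore] -/
theorem mem_ballLabels_two_table :
    ∀ u ∈ ({(0, 0, 0), (0, -1, 1), (0, 1, 0), (0, 0, 1), (1, -1, 0), (1, -2, 1), (1, 0, 0), (1, -1, 1), (0, 1, -1),
      (0, -1, 0), (0, 0, -1), (-1, -1, 0), (-1, 0, -1), (-1, -2, 0), (-1, -1, -1)} : Finset (ℤ × ℤ × ℤ)),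
      u ∈ ballLabels 2 := by
  have star : ∀ ε ∈ hcpStarIdx, ε ∈ ballLabels 2 := fun ε hε => by
    have := nbr_mem_ballLabels_succ 0 0 (zero_mem_ballLabels 0) ε hε
    rw [RootedChartUnique.nbr_zero] at this
    exact ballLabels_mono 1 this
  have two : ∀ ε₁ ∈ hcpStarIdx, ∀ ε₂ ∈ hcpStarIdx, nbr ε₁ ε₂ ∈ ballLabels 2 := fun ε₁ h₁ ε₂ h₂ => by
    have := nbr_mem_ballLabels_succ 1 (nbr 0 ε₁) (nbr_mem_ballLabels_succ 0 0 (zero_mem_ballLabels 0) ε₁ h₁) ε₂ h₂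
    rwa [RootedChartUnique.nbr_zero] at this
  intro u hu
  simp only [Finset.mem_insert, Finset.mem_singleton] at hu
  rcases hu with rfl | rfl | rfl | rfl | rfl | rfl | rfl | rfl | rfl | rfl | rfl | rfl | rfl | rfl | rfl
  · exact zero_mem_ballLabels 2
  · exact star _ (by decide)
  · exact star _ (by decide)
  · exact star _ (by decide)
  · exact star _ (by decide)
  · have e : nbr ((1, -1, 0) : ℤ × ℤ × ℤ) (0, 1, -1) = (1, -2, 1) := by decide
    exact e ▸ two _ (by decide) _ (by decide)
  · exact star _ (by decide)
  · have e : nbr ((1, -1, 0) : ℤ × ℤ × ℤ) (0, 0, -1) = (1, -1, 1) := by decide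
    exact e ▸ two _ (by decide) _ (by decide)
  · exact star _ (by decide)
  · exact star _ (by decide)
  · exact star _ (by decide)
  · exact star _ (by decide)
  · exact star _ (by decide)
  · have e : nbr ((-1, -1, 0) : ℤ × ℤ × ℤ) (0, 1, 0) = (-1, -2, 0) := by decide
    exact e ▸ two _ (by decide) _ (by decide)
  · have e : nbr ((-1, -1, 0) : ℤ × ℤ × ℤ) (0, 0, 1) = (-1, -1, -1) := by decide
    exact e ▸ two _ (by decide) _ (by decide)

/-- **The Kuhn star of `m` lies in the graph ball of radius `2` around `kuhnLabel m`**: for an offset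
`σ ∈ {0,1}³ ∪ {−1,0}³` the label `kuhnLabel (m + σ)` is `labelShift (kuhnLabel m) u` with `u ∈ ballLabels 2`
(`u = (σ₁, σ₂ − σ₃ − |σ₁|, σ₃)` for an even-layer centre, its negative-offset twin for an odd one). [folklore] -/
theorem kuhnLabel_offset_mem (m σ : ℤ × ℤ × ℤ)
    (hσ : ((σ.1 = 0 ∨ σ.1 = 1) ∧ (σ.2.1 = 0 ∨ σ.2.1 = 1) ∧ (σ.2.2 = 0 ∨ σ.2.2 = 1)) ∨
      ((σ.1 = 0 ∨ σ.1 = -1) ∧ (σ.2.1 = 0 ∨ σ.2.1 = -1) ∧ (σ.2.2 = 0 ∨ σ.2.2 = -1))) :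
    ∃ u ∈ ballLabels 2, kuhnLabel (m + σ) = labelShift (kuhnLabel m) u := by
  obtain ⟨m₁, m₂, m₃⟩ := m
  obtain ⟨σ₁, σ₂, σ₃⟩ := σ
  simp only at hσ
  have tab := mem_ballLabels_two_table
  simp only [Finset.mem_insert, Finset.mem_singleton, forall_eq_or_imp, forall_eq] at tab
  obtain ⟨t0, t1, t2, t3, t4, t5, t6, t7, t8, t9, t10, t11, t12, t13, t14⟩ := tab
  by_cases hm : Even m₁
  · -- even-layer centre: `labelShift c u = c + u`, `u = (σ₁, σ₂ − σ₃ − |σ₁|, σ₃)`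
    refine ⟨(σ₁, σ₂ - σ₃ - |σ₁|, σ₃), ?_, ?_⟩
    · rcases hσ with ⟨h1 | h1, h2 | h2, h3 | h3⟩ | ⟨h1 | h1, h2 | h2, h3 | h3⟩ <;> subst h1 h2 h3 <;> assumption
    · have hm0 : m₁ % 2 = 0 := Int.even_iff.1 hm
      have hs : (m₁ + σ₁) % 2 = |σ₁| := by
        rcases hσ with ⟨h1 | h1, -, -⟩ | ⟨h1 | h1, -, -⟩ <;> subst h1 <;>
          simp only [abs_zero, abs_one, abs_neg, add_zero] <;> omega
      simp only [kuhnLabel, labelShift, if_pos hm, Prod.mk_add_mk, hs, hm0, Prod.mk.injEq]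
      refine ⟨trivial, by ring, trivial⟩
  · -- odd-layer centre: `labelShift c u = c − u`, `u = (−σ₁, −σ₂ + σ₃ − |σ₁|, −σ₃)`
    refine ⟨(-σ₁, -σ₂ + σ₃ - |σ₁|, -σ₃), ?_, ?_⟩
    · rcases hσ with ⟨h1 | h1, h2 | h2, h3 | h3⟩ | ⟨h1 | h1, h2 | h2, h3 | h3⟩ <;> subst h1 h2 h3 <;> assumption
    · have hm0 : m₁ % 2 = 1 := Int.odd_iff.1 (Int.not_even_iff_odd.1 hm)
      have hs : (m₁ + σ₁) % 2 = 1 - |σ₁| := by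
        rcases hσ with ⟨h1 | h1, -, -⟩ | ⟨h1 | h1, -, -⟩ <;> subst h1 <;>
          simp only [abs_zero, abs_one, abs_neg, add_zero] <;> omega
      simp only [kuhnLabel, labelShift, if_neg hm, Prod.mk_add_mk, Prod.mk_sub_mk, hs, hm0, Prod.mk.injEq]
      refine ⟨by ring, by ring, by ring⟩

/-- **Offsets of the threshold labels of a point of a good box**, packaged: for `x` in the box `(m, τ)` and
`t ∈ (0,1)`, the triple `v = ⌈x − t⌉` has offset `v − m ∈ {0,1}³ ∪ {−1,0}³`, and `v₁ − m₁ ≥ 0` if `x₁ ≥ m₁`,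
`≤ 0` if `x₁ ≤ m₁`. [folklore] -/
theorem offsets_of_box {x : ℝ × ℝ × ℝ} {m : ℤ × ℤ × ℤ} {τ t : ℝ} (hτ0 : 0 ≤ τ) (hτ1 : τ ≤ 1) (ht0 : 0 < t)
    (ht1 : t < 1)
    (hb : (τ - 1 ≤ x.1 - m.1 ∧ x.1 - m.1 ≤ τ) ∧ (τ - 1 ≤ x.2.1 - m.2.1 ∧ x.2.1 - m.2.1 ≤ τ) ∧
      (τ - 1 ≤ x.2.2 - m.2.2 ∧ x.2.2 - m.2.2 ≤ τ))
    (v : ℤ × ℤ × ℤ) (hv : v = (⌈x.1 - t⌉, ⌈x.2.1 - t⌉, ⌈x.2.2 - t⌉)) :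
    ((((v - m).1 = 0 ∨ (v - m).1 = 1) ∧ ((v - m).2.1 = 0 ∨ (v - m).2.1 = 1) ∧ ((v - m).2.2 = 0 ∨ (v - m).2.2 = 1)) ∨
      (((v - m).1 = 0 ∨ (v - m).1 = -1) ∧ ((v - m).2.1 = 0 ∨ (v - m).2.1 = -1) ∧
        ((v - m).2.2 = 0 ∨ (v - m).2.2 = -1))) ∧
      (0 ≤ x.1 - m.1 → 0 ≤ (v - m).1) ∧ (x.1 - m.1 ≤ 0 → (v - m).1 ≤ 0) := by
  subst hv
  obtain ⟨a1, b1, c1, d1⟩ := ceil_offset_cases (m := m.1) hτ0 hτ1 ht0 ht1 hb.1.1 hb.1.2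
  obtain ⟨a2, b2, -, -⟩ := ceil_offset_cases (m := m.2.1) hτ0 hτ1 ht0 ht1 hb.2.1.1 hb.2.1.2
  obtain ⟨a3, b3, -, -⟩ := ceil_offset_cases (m := m.2.2) hτ0 hτ1 ht0 ht1 hb.2.2.1 hb.2.2.2
  simp only [Prod.fst_sub, Prod.snd_sub]
  refine ⟨?_, c1, d1⟩
  by_cases htτ : t < τ
  · exact Or.inl ⟨a1 htτ, a2 htτ, a3 htτ⟩
  · exact Or.inr ⟨b1 (not_lt.1 htτ), b2 (not_lt.1 htτ), b3 (not_lt.1 htτ)⟩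

end KuhnChart

/-- **Anchor (registered sub-goal of stmt-AtomisticToContinuum-9226)**: `√2 / 25 ≤ 1/16` — a ball of radius `1/25` is read
inside a Kuhn sup-ball of radius `1/16` (`√2 ≤ 3/2`). [folklore] -/
theorem sqrt2_div_25_le : Real.sqrt 2 * (1 / 25 : ℝ) ≤ 1 / 16 := by
  have h2 : Real.sqrt 2 ≤ 3 / 2 := by
    rw [show (3 / 2 : ℝ) = Real.sqrt ((3 / 2) ^ 2) by rw [Real.sqrt_sq (by norm_num)]]
    exact Real.sqrt_le_sqrt (by norm_num)
  linarith

end Summit.AtomisticToContinuum.Crystallization.Theorems.PalmUnimodularRigidity.LayeredLawsSelectHcp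

end
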